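import Mathlib
import Summits.Ventures.HodgeRepro2.T5LocalComponent
import Summits.Ventures.HodgeRepro2.T5TrivialPartner
import Summits.Ventures.HodgeRepro2.T6N42Datum

/-!
# T6N42FlathLift — the N4.2 residual `hFL` («π₀,v = θ_{W₁₂,v}(β′_v)» at every non-split place)
under the Flath route: the «global ≠ 0 ⟹ local ≠ 0» restriction, in kernel over abstract
factorization data (owner t6-p5)

THE RESIDUAL. `FinitePlacesDatum.FirstLift D` (`T6N42Datum.lean`) reads TIER5 §B's standing datum
(route/TIER5.md v0.57 l. 464: «at every finite v, π₀,v = θ_{W₁₂,v}(β′_v) is the local lift of β′_v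
(the global lift is a restricted tensor product of local lifts — [A, standard; the same «global ⟹
local» as T4N §2(i)])») as `∀ v, HasPartner ((D.towerDatum v).ω 0) (D.towerDatum v).π
(charLinRep (D.β' v))`, i.e. `Hom_{G(W)×H(V₀)}(ω_{V₀,v}, π₀,v ⊠ β′_v) ≠ 0` at every non-split
place — the residual binders `hFLA` / `hFLB` of `HCCMOfPublished₂` (residual ledger rows 93 / 136;
memo route/T6-N42-HOST-t6-p5.md §10: «`hFL` 0 print / 1 construction»).

THE ARGUMENT (TIER5 row N2.2.1, l. 276: «a non-zero theta integral exhibits a non-zero element of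
Hom_{U(V)(𝔸)}(ω_ψ ⊗ σ̄, 𝟙); ω_ψ = ⊗′ω_{ψ,v}, σ̄ = ⊗′σ̄_v restricted tensor products of irreducible
smooth representations; a non-zero invariant functional on a restricted tensor product has non-zero
v-components (T4N §2(i))»; kernel witness N2.17.1 = p3's `T5LocalComponent.lean` p393898). Read at
ONE place `v`, a restricted tensor product `⊗′_u π_u` IS the ordinary tensor product `π_v ⊗ π^{(v)}`
of the `v`-component with the away-from-`v` product, as a representation of `G_v × G^{(v)}`; so the
global theta map `Θ : ω_𝔸 → π₀ ⊠ β′` (non-zero by TIER5 (E1), `G(𝔸) × H(𝔸)`-equivariant), read at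
`v` through the two factorizations, is a non-zero intertwiner `ω_v ⊗ ω^{(v)} → (π₀,v ⊠ β′_v) ⊗
(π₀^{(v)} ⊠ β′^{(v)})`, and p3's `hasPartner_of_extTprod` (the kernel form of «a non-zero
equivariant map out of a two-fold tensor product has a non-zero first component») yields exactly
`HasPartner ω_v π₀,v β′_v`. NOTHING about the local theta lift `θ_{W₁₂,v}(β′_v)` or Howe duality is
needed for `FirstLift` AS THE KERNEL STATES IT; the identification «π₀,v = θ(β′_v)» of print is not
consumed (memo §10, the §5 cut set aside).

THIS FILE (with `T6N42FlathLiftRead.lean`) puts that reading in kernel as an INTERFACE the host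
instance fills. FORM (t6-p3's
concordance note, STATUS l. 12531, adopted): every structure below carries OBJECTS only; its laws are
a separate `Prop`-valued structure, so that on an install the host obligation is counted by name as
«DATA + RESIDUAL laws» (p3's binder census reads binders, not fields of a data type):
* `LocalFactorizationAt ω σ π` (objects) + `LocalFactorizationAt.IsFactorization` (laws: `Φ ≠ 0`,
  `Φ` intertwining) — the global theta map read at one place: an away-from-`v` group `G'` with
  representations `ω'` (the away factor of `ω_𝔸`) and `τ₂` (the away factor of `π₀ ⊠ β′`), and the
  intertwiner `Φ : V ⊗ A₂ → (V₁ ⊗ V₂) ⊗ B₂` for `ω ⊠ ω' → (σ ⊠ π) ⊠ τ₂`;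
  `LocalFactorizationAt.hasPartner : HasPartner ω σ π` (p3's lemma); conversely
  `LocalFactorizationAt.ofMap` (trivial away data) satisfies the laws for a local partner — so
  `exists_localFactorizationAt_iff`: the interface is a FAITHFUL re-packaging of the residual.
* `GlobalLiftDatum` (objects: `ω_𝔸` on `G(𝔸) × H(𝔸)`, `π₀`, the Hecke character `β′`, the theta map
  `Θ`) + `GlobalLiftDatum.IsLift` (laws: `Θ ≠ 0`, equivariance — TIER5 (E1) in the `HasPartner`
  vocabulary, `GlobalLiftDatum.hasPartner`).
* in `T6N42FlathLiftRead.lean`: `ReadAtPlace Gl ω σ π` (objects: a group isomorphism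
  `ι : (G × H) × G' ≃* G(𝔸) × H(𝔸)` and two linear isomorphisms `eΩ : Ω ≃ V ⊗ A₂`, `ePi : Vπ ⊗ ℂ ≃
  (V₁ ⊗ V₂) ⊗ B₂`) + `ReadAtPlace.IsReading` (laws: each intertwines the global representation pulled
  back along `ι` with the two-factor tensor product) — the Flath factorizations of `ω_𝔸` and of
  `π₀ ⊠ β′` at `v`, the ONE identification per place that `hIS` (`T6N42FlathDatum.ReadAs`) and `hFL`
  share (memo §10); `ReadAtPlace.toLocalFactorizationAt` transports `Θ` (`Φ := ePi ∘ Θ ∘ eΩ⁻¹`),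
  `ReadAtPlace.hasPartner`; `FirstLiftReading D` (objects: one `GlobalLiftDatum` + a reading at every
  non-split place of `D`) + `FirstLiftReading.IsReading` (its laws); **`FirstLiftReading.firstLift :
  D.FirstLift`** = the residual `hFL` discharged from the host's global objects and factorizations,
  with NO new print (the only printed input of the lane stays the Flath display of
  `T6N42HypFlath.lean`, consumed by `hIS`; the factorization data are the same).
* Non-vacuity (§10.5(ii)(c)/(d)): `GlobalLiftDatum.ofHasPartner` here; `ReadAtPlace.self`,
  `toyGlobal`, `toyFirstLiftReading : FirstLiftReading toyFinitePlaces` with their laws and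
  `toyFinitePlaces_firstLift_read` — the toy datum's `FirstLift` re-derived through the interface —
  in `T6N42FlathLiftToy.lean`; the host seam `FirstLiftSide` in `T6N42FlathLiftHost.lean`.

Proof lane (structures, `def`s, theorems; no display — nothing here is a printed statement).
README §8(d): uses an L-value-free non-vanishing device: NO (TIER5 §N4.2 / §B, pre-02:16Z lines of
record, continued).

Filed in Tier-6 WAVE 1 as p437415 (proposed 2026-08-26T10:14:25Z, ACCEPTED, commit af62534bcc3b);
this v2 differs from the filed bytes in this module docstring only (the staged-record wording
dropped; every declaration byte-identical to v1).
-/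

namespace Summit.Ventures.HodgeRepro2.T6.N42Flath

open Summit.Ventures.HodgeRepro2
open Summit.Ventures.HodgeRepro2.T5DualPairSwap
open Summit.Ventures.HodgeRepro2.T5SplittingTwist
open Summit.Ventures.HodgeRepro2.T5LocalComponent
open Summit.Ventures.HodgeRepro2.T5TrivialPartner
open Summit.Ventures.HodgeRepro2.T6.N42Defs
open Summit.Ventures.HodgeRepro2.T6.N42Datum
open TensorProduct

section Local

variable {G H : Type*} [Monoid G] [Monoid H] {V V₁ V₂ : Type*}
  [AddCommGroup V] [Module ℂ V] [AddCommGroup V₁] [Module ℂ V₁] [AddCommGroup V₂] [Module ℂ V₂]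

/-- The global theta map READ AT ONE PLACE `v` (TIER5 row N2.2.1's restriction step), OBJECTS: an
away-from-`v` group `G'` (= `G(𝔸^{v}) × H(𝔸^{v})`), the away factor `ω'` of the global Weil
representation `ω_𝔸 ≅ ω ⊗ ω'`, the away factor `τ₂` of `π₀ ⊠ β′ ≅ (σ ⊠ π) ⊗ τ₂`, and the theta map
as a linear map `Φ : V ⊗ A₂ → (V₁ ⊗ V₂) ⊗ B₂` (the restricted tensor product at `v` = the two-fold
tensor product «`v`-component ⊗ away part»). Its laws are `IsFactorization`. Nothing is constructed;
the host supplies the fields. -/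
structure LocalFactorizationAt (ω : Representation ℂ (G × H) V) (σ : Representation ℂ G V₁)
    (π : Representation ℂ H V₂) where
  /-- the away-from-`v` group `G(𝔸^{v}) × H(𝔸^{v})` -/
  G' : Type
  [instMonoid : Monoid G']
  /-- the space of the away factor `ω^{(v)}` of `ω_𝔸` -/
  A₂ : Type
  [instAddA : AddCommGroup A₂]
  [instModA : Module ℂ A₂]
  /-- the away factor `ω^{(v)}` -/
  ω' : Representation ℂ G' A₂
  /-- the space of the away factor `π₀^{(v)} ⊠ β′^{(v)}` of `π₀ ⊠ β′` -/
  B₂ : Type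
  [instAddB : AddCommGroup B₂]
  [instModB : Module ℂ B₂]
  /-- the away factor `π₀^{(v)} ⊠ β′^{(v)}` -/
  τ₂ : Representation ℂ G' B₂
  /-- the global theta map, read at `v` -/
  Φ : V ⊗[ℂ] A₂ →ₗ[ℂ] (V₁ ⊗[ℂ] V₂) ⊗[ℂ] B₂

namespace LocalFactorizationAt

variable {ω : Representation ℂ (G × H) V} {σ : Representation ℂ G V₁} {π : Representation ℂ H V₂}
variable (L : LocalFactorizationAt ω σ π)

/-- The monoid structure of the away group. -/
instance instMonoid' : Monoid L.G' := L.instMonoid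

/-- The additive group of the away factor of `ω_𝔸`. -/
instance instAddA' : AddCommGroup L.A₂ := L.instAddA

/-- The `ℂ`-module structure of the away factor of `ω_𝔸`. -/
instance instModA' : Module ℂ L.A₂ := L.instModA

/-- The additive group of the away factor of `π₀ ⊠ β′`. -/
instance instAddB' : AddCommGroup L.B₂ := L.instAddB

/-- The `ℂ`-module structure of the away factor of `π₀ ⊠ β′`. -/
instance instModB' : Module ℂ L.B₂ := L.instModB

/-- The LAWS of a factorization at `v`: the theta map read at `v` is non-zero (TIER5 (E1)) and
`(G_v × H_v) × G'`-equivariant. -/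
structure IsFactorization (L : LocalFactorizationAt ω σ π) : Prop where
  /-- TIER5 (E1): the theta map is non-zero -/
  Φ_ne_zero : L.Φ ≠ 0
  /-- the theta map is `(G_v × H_v) × G'`-equivariant -/
  Φ_intertwining : (extTprod ω L.ω').IsIntertwiningMap (extTprod (extTprod σ π) L.τ₂) L.Φ

/-- «global ≠ 0 ⟹ local ≠ 0» (TIER5 row N2.2.1, kernel witness N2.17.1): a global theta map read
at `v` gives the local partner — `Hom_{G_v×H_v}(ω_v, σ ⊠ π) ≠ 0`. p3's
`T5LocalComponent.hasPartner_of_extTprod`, applied to the fields and the laws. -/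
theorem hasPartner (L : LocalFactorizationAt ω σ π) (hL : L.IsFactorization) :
    HasPartner ω σ π :=
  hasPartner_of_extTprod ω L.ω' σ π L.τ₂ hL.Φ_ne_zero hL.Φ_intertwining

end LocalFactorizationAt

/-- A non-zero linear map tensored with the identity of `ℂ` is non-zero. -/
theorem rTensor_id_ne_zero {W₁ W₂ : Type*} [AddCommGroup W₁] [Module ℂ W₁] [AddCommGroup W₂]
    [Module ℂ W₂] {f : W₁ →ₗ[ℂ] W₂} (hf : f ≠ 0) :
    TensorProduct.map f (LinearMap.id : ℂ →ₗ[ℂ] ℂ) ≠ 0 := by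
  intro h
  apply hf
  ext w
  have h1 := LinearMap.congr_fun h (w ⊗ₜ[ℂ] (1 : ℂ))
  simp only [TensorProduct.map_tmul, LinearMap.id_coe, id_eq, LinearMap.zero_apply] at h1
  have h2 : (TensorProduct.rid ℂ W₂).symm (f w) = 0 := by
    rw [TensorProduct.rid_symm_apply]; exact h1
  simpa using (TensorProduct.rid ℂ W₂).symm.map_eq_zero_iff.mp h2

/-- Conversely, a local map `f : V → V₁ ⊗ V₂` IS a factorization with trivial away data (`G' = 1`,
`A₂ = B₂ = ℂ`, `Φ = f ⊗ id`). -/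
def LocalFactorizationAt.ofMap (ω : Representation ℂ (G × H) V) (σ : Representation ℂ G V₁)
    (π : Representation ℂ H V₂) (f : V →ₗ[ℂ] V₁ ⊗[ℂ] V₂) : LocalFactorizationAt ω σ π where
  G' := Unit
  A₂ := ℂ
  ω' := Representation.trivial ℂ Unit ℂ
  B₂ := ℂ
  τ₂ := Representation.trivial ℂ Unit ℂ
  Φ := TensorProduct.map f LinearMap.id

/-- … and it satisfies the laws when `f` is a non-zero intertwiner (a local partner): the interface
does not strengthen the residual. -/
theorem LocalFactorizationAt.isFactorization_ofMap {ω : Representation ℂ (G × H) V}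
    {σ : Representation ℂ G V₁} {π : Representation ℂ H V₂} (f : V →ₗ[ℂ] V₁ ⊗[ℂ] V₂) (hf : f ≠ 0)
    (hint : ω.IsIntertwiningMap (extTprod σ π) f) :
    (LocalFactorizationAt.ofMap ω σ π f).IsFactorization where
  Φ_ne_zero := rTensor_id_ne_zero hf
  Φ_intertwining := by
    show (extTprod ω (Representation.trivial ℂ Unit ℂ)).IsIntertwiningMap
      (extTprod (extTprod σ π) (Representation.trivial ℂ Unit ℂ)) (TensorProduct.map f LinearMap.id)
    refine ⟨fun x u => ?_⟩
    induction u using TensorProduct.induction_on with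
    | zero => simp
    | tmul v a =>
      simp only [extTprod_apply, TensorProduct.map_tmul, LinearMap.id_coe, id_eq]
      rw [hint.isIntertwining x.1 v, extTprod_apply]
    | add u₁ u₂ h₁ h₂ => simp only [map_add, h₁, h₂]

/-- `(∃ L, L.IsFactorization) ↔ HasPartner ω σ π`: the interface is a faithful re-packaging of the
residual `hFL` at one place. -/
theorem exists_localFactorizationAt_iff (ω : Representation ℂ (G × H) V)
    (σ : Representation ℂ G V₁) (π : Representation ℂ H V₂) :
    (∃ L : LocalFactorizationAt ω σ π, L.IsFactorization) ↔ HasPartner ω σ π :=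
  ⟨fun ⟨L, hL⟩ => L.hasPartner hL, fun ⟨f, hf, hint⟩ =>
    ⟨LocalFactorizationAt.ofMap ω σ π f, LocalFactorizationAt.isFactorization_ofMap f hf hint⟩⟩

end Local

/-- The GLOBAL objects of TIER5 §B (l. 464) as data: `G(𝔸) × H(𝔸)` (`U(W₁₂)(𝔸) × U(V′)(𝔸)`) with
the global Weil representation `ω_𝔸` on `Ω`, the global lift `π₀` on `Vπ`, the Hecke character `β′`
of `H(𝔸)`, and the theta map `Θ : ω_𝔸 → π₀ ⊠ β′`. Its laws (`Θ ≠ 0` — TIER5 (E1): `π₀ =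
Θ_{V′→W₁₂}(β′) ≠ 0` — and equivariance) are `IsLift`. Nothing is constructed (the B3 pattern): the
theta integral, the adelic groups and `L²([U(W₁₂)])` are t6-p3's host d3 objects (the C8 caveat; the
seam is `T6N42FlathLiftHost.FirstLiftSide`). -/
structure GlobalLiftDatum where
  /-- `G(𝔸) = U(W₁₂)(𝔸)` -/
  GA : Type
  [instMonoidGA : Monoid GA]
  /-- `H(𝔸) = U(V′)(𝔸) = E¹(𝔸)` -/
  HA : Type
  [instMonoidHA : Monoid HA]
  /-- the space of the global Weil representation -/
  Ω : Type
  [instAddΩ : AddCommGroup Ω]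
  [instModΩ : Module ℂ Ω]
  /-- the global Weil representation `ω_𝔸` of `G(𝔸) × H(𝔸)` -/
  ωA : Representation ℂ (GA × HA) Ω
  /-- the space of the global lift `π₀` -/
  Vπ : Type
  [instAddVπ : AddCommGroup Vπ]
  [instModVπ : Module ℂ Vπ]
  /-- the global lift `π₀ = Θ_{V′→W₁₂}(β′)` as a representation of `G(𝔸)` -/
  πA : Representation ℂ GA Vπ
  /-- the Hecke character `β′` of `H(𝔸)` -/
  βA : HA →* ℂˣ
  /-- the theta map `ω_𝔸 → π₀ ⊠ β′` -/
  Θ : Ω →ₗ[ℂ] Vπ ⊗[ℂ] ℂ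

namespace GlobalLiftDatum

variable (Gl : GlobalLiftDatum)

/-- The monoid structure of `G(𝔸)`. -/
instance instMonoidGA' : Monoid Gl.GA := Gl.instMonoidGA

/-- The monoid structure of `H(𝔸)`. -/
instance instMonoidHA' : Monoid Gl.HA := Gl.instMonoidHA

/-- The additive group of the space of `ω_𝔸`. -/
instance instAddΩ' : AddCommGroup Gl.Ω := Gl.instAddΩ

/-- The `ℂ`-module structure of the space of `ω_𝔸`. -/
instance instModΩ' : Module ℂ Gl.Ω := Gl.instModΩ

/-- The additive group of the space of `π₀`. -/
instance instAddVπ' : AddCommGroup Gl.Vπ := Gl.instAddVπ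

/-- The `ℂ`-module structure of the space of `π₀`. -/
instance instModVπ' : Module ℂ Gl.Vπ := Gl.instModVπ

/-- The LAWS of a global lift datum: the theta map is non-zero (TIER5 (E1)) and
`G(𝔸) × H(𝔸)`-equivariant. -/
structure IsLift (Gl : GlobalLiftDatum) : Prop where
  /-- TIER5 (E1): the theta map is non-zero -/
  Θ_ne_zero : Gl.Θ ≠ 0
  /-- the theta map is `G(𝔸) × H(𝔸)`-equivariant -/
  Θ_intertwining : Gl.ωA.IsIntertwiningMap (extTprod Gl.πA (charLinRep Gl.βA)) Gl.Θ

/-- TIER5 (E1) in the `HasPartner` vocabulary: `Hom_{G(𝔸)×H(𝔸)}(ω_𝔸, π₀ ⊠ β′) ≠ 0`. -/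
theorem hasPartner (Gl : GlobalLiftDatum) (h : Gl.IsLift) :
    HasPartner Gl.ωA Gl.πA (charLinRep Gl.βA) :=
  ⟨Gl.Θ, h.Θ_ne_zero, h.Θ_intertwining⟩

/-- A global datum from any global partner (non-vacuity; the witness is chosen). -/
noncomputable def ofHasPartner {GA HA Ω Vπ : Type} [Monoid GA] [Monoid HA] [AddCommGroup Ω]
    [Module ℂ Ω] [AddCommGroup Vπ] [Module ℂ Vπ] (ωA : Representation ℂ (GA × HA) Ω)
    (πA : Representation ℂ GA Vπ) (βA : HA →* ℂˣ) (h : HasPartner ωA πA (charLinRep βA)) :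
    GlobalLiftDatum where
  GA := GA
  HA := HA
  Ω := Ω
  ωA := ωA
  Vπ := Vπ
  πA := πA
  βA := βA
  Θ := h.choose

/-- … satisfying the laws. -/
theorem isLift_ofHasPartner {GA HA Ω Vπ : Type} [Monoid GA] [Monoid HA] [AddCommGroup Ω]
    [Module ℂ Ω] [AddCommGroup Vπ] [Module ℂ Vπ] (ωA : Representation ℂ (GA × HA) Ω)
    (πA : Representation ℂ GA Vπ) (βA : HA →* ℂˣ) (h : HasPartner ωA πA (charLinRep βA)) :
    (ofHasPartner ωA πA βA h).IsLift where
  Θ_ne_zero := h.choose_spec.1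
  Θ_intertwining := h.choose_spec.2

end GlobalLiftDatum

end Summit.Ventures.HodgeRepro2.T6.N42Flath
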